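import Literature.NumberTheory.Sieve.CubicMinorantDefs
import Literature.NumberTheory.Sieve.CircleMethodTernaryProofs
import Mathlib.MeasureTheory.Integral.MeanInequalities
import Mathlib.MeasureTheory.Integral.IntervalIntegral.Basic
import Mathlib.Analysis.SpecialFunctions.Pow.Real
import HarnessLib

/-!
# The Hölder counting lemma for weighted ternary sums (circle method), PROVED

Topic `Literature/NumberTheory/Sieve`, namespace `Literature.NumberTheory.Sieve.CubicMinorant` (the
objects `expSumOf f N α = ∑_{n ≤ N} f(n) e(nα)` and `ternarySum f₁ f₂ f₃ N = ∑_{n₁+n₂+n₃=N} f₁f₂f₃`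
are the tree's, `CubicMinorantDefs.lean`). For real weights `f₁, f₂, f₃` on `{0, …, N}` with
`sup_α |f̂ᵢ(α)| ≤ Uᵢ` (`i = 1, 2`):

  `|∑_{n₁+n₂+n₃=N} f₁(n₁)f₂(n₂)f₃(n₃)| ≤ (U₁U₂)^{1/4} (‖f₁‖₂² ‖f₂‖₂²)^{3/8} (∫₀¹ |f̂₃|⁴)^{1/4}`

(`HolderCounting`, stated exactly as the parity-ideate cell's Line-E block E5, and PROVED:
`holderCounting_holds`). The proof is the standard one: orthogonality
`∑_{n₁+n₂+n₃=N} ∏ fᵢ(nᵢ) = ∫₀¹ f̂₁f̂₂f̂₃ e(−Nα) dα` [Vaughan1997, §1.2], Hölder with exponents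
`(4/3, 4)`, the pointwise bound `(|f̂₁||f̂₂|)^{4/3} ≤ (U₁U₂)^{1/3}|f̂₁||f̂₂|`, Cauchy–Schwarz and
Parseval `∫₀¹|f̂|² = ∑ f(n)²` [Vaughan1997, §3.2] — the mechanism by which ternary counts are
controlled through `L^q` norms on the Fourier side [TaoVu2006, §10.2]. It is the read-out engine of
weighted ternary problems in which one variable carries a thin weight controlled only through its
fourth moment (restriction-type input).

Provenance: text = section "E5 PROVED" of the cell evidence file
`run/shared/lean/pub/parity-ideate/parity-ideate-p2/evidence/LineEFG_tree.lean` (planner seat p2,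
2026-08-25, sha256 f7029116…, refereed PASS—KERNEL; statements unchanged, helpers privatised, tags
added), landed by the cell's literature seat. The cell's NEW theorems built on it (the thin-weight
criteria of Line G, the targets of Lines E/F) are not literature and live under `Summits/`.

## References
* [Vaughan1997] R. C. Vaughan, *The Hardy–Littlewood method*, 2nd ed., Cambridge Tracts 125, CUP 1997,
  §1.2 (generating functions, orthogonality), §3.2 (Parseval and Cauchy on the minor arcs).
* [TaoVu2006] T. Tao, V. Vu, *Additive Combinatorics*, CUP 2006, §10.2 (Theorem 10.20, Lemma 10.22:
  counting 3-term configurations through `L^q` bounds on Fourier transforms).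
-/

noncomputable section

open scoped FourierTransform
open Finset MeasureTheory Filter Literature.NumberTheory.Sieve

namespace Literature.NumberTheory.Sieve.CubicMinorant

/-- **The Hölder counting lemma** (statement; PROVED below as `holderCounting_holds`). For real
weights on `[0, N]`, `|∑_{n₁+n₂+n₃=N} f₁f₂f₃| ≤ (U₁U₂)^{1/4} (‖f₁‖₂² ‖f₂‖₂²)^{3/8} (∫₀¹|f̂₃|⁴)^{1/4}`
whenever `‖f̂ᵢ‖_∞ ≤ Uᵢ` (`i = 1, 2`). Verbatim the cell's Line-E block E5.
[cite: TaoVu2006, §10.2 (ternary counts controlled by L^q norms on the Fourier side, cf. Theorem 10.20)] -/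
def HolderCounting : Prop :=
  ∀ (f₁ f₂ f₃ : ℕ → ℝ) (N : ℕ) (U₁ U₂ : ℝ), 0 ≤ U₁ → 0 ≤ U₂ →
    (∀ α : ℝ, ‖expSumOf f₁ N α‖ ≤ U₁) → (∀ α : ℝ, ‖expSumOf f₂ N α‖ ≤ U₂) →
      |ternarySum f₁ f₂ f₃ N| ≤
        (U₁ * U₂) ^ ((1 : ℝ) / 4) *
          ((∑ n ∈ range (N + 1), f₁ n ^ 2) * (∑ n ∈ range (N + 1), f₂ n ^ 2)) ^ ((3 : ℝ) / 8) *
            (∫ α in (0 : ℝ)..1, ‖expSumOf f₃ N α‖ ^ 4) ^ ((1 : ℝ) / 4)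

/-! ### Continuity and the trivial bound -/

/-- `α ↦ ∑_{n ≤ N} f(n) e(nα)` is continuous (a trigonometric polynomial). [cite: Vaughan1997, §1.2 (the generating functions of the circle method are finite exponential sums)] -/
theorem continuous_expSumOf (f : ℕ → ℝ) (N : ℕ) : Continuous (expSumOf f N) := by
  unfold expSumOf; fun_prop

/-- The trivial bound `|∑_{n ≤ N} f(n) e(nα)| ≤ ∑_{n ≤ N} |f(n)|`. [cite: Vaughan1997, §1.2 (trivial estimate for a generating function)] -/
theorem norm_expSumOf_le (f : ℕ → ℝ) (N : ℕ) (α : ℝ) :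
    ‖expSumOf f N α‖ ≤ ∑ n ∈ range (N + 1), |f n| := by
  unfold expSumOf
  refine (norm_sum_le _ _).trans (le_of_eq (Finset.sum_congr rfl fun n _ ↦ ?_))
  rw [norm_mul, Circle.norm_coe, mul_one, Complex.norm_real, Real.norm_eq_abs]

/-- `|f̂|` is in every `L^p` of a finite measure (bounded continuous; private helper). [folklore] -/
private theorem memLp_norm_expSumOf (f : ℕ → ℝ) (N : ℕ) (p : ENNReal) (μ : Measure ℝ) [IsFiniteMeasure μ] :
    MemLp (fun α ↦ ‖expSumOf f N α‖) p μ :=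
  MemLp.of_bound (continuous_expSumOf f N).norm.aestronglyMeasurable (∑ n ∈ range (N + 1), |f n|)
    (Filter.Eventually.of_forall fun α ↦ by
      simpa only [norm_norm] using norm_expSumOf_le f N α)

/-! ### Orthogonality: `T = ∫₀¹ F₁ F₂ F₃ e(−Nα)` -/

/-- Orthogonality: `∫₀¹ (∏ᵢ f̂ᵢ(α)) e(−Nα) dα = ∑_{x₁+⋯+x_k=N} ∏ᵢ fᵢ(xᵢ)` (tree pattern:
`integral_primeExpSum_pow_mul_fourierChar`). [cite: Vaughan1997, §1.2 (the number of representations as the integral of the product of generating functions against e(−Nα))] -/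
theorem integral_prod_expSumOf_mul_fourierChar (k : ℕ) (f : Fin k → ℕ → ℝ) (N : ℕ) :
    ∫ α in (0 : ℝ)..1, (∏ i, expSumOf (f i) N α) * (𝐞 (-(N * α)) : ℂ) =
      ∑ x ∈ Finset.Nat.antidiagonalTuple k N, ∏ i, (f i (x i) : ℂ) := by
  have hchar : ∀ (x : Fin k → ℕ) (α : ℝ),
      (∏ i, (𝐞 ((x i : ℝ) * α) : ℂ)) * (𝐞 (-(N * α)) : ℂ) =
        (𝐞 ((((∑ i, x i : ℕ) : ℤ) - N : ℤ) * α) : ℂ) := by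
    intro x α
    simp only [Real.fourierChar_apply, ← Complex.exp_sum, ← Complex.exp_add]
    congr 1
    push_cast
    simp only [← Finset.sum_mul, ← Finset.mul_sum]
    ring
  have hI : ∀ α : ℝ, (∏ i, expSumOf (f i) N α) * (𝐞 (-(N * α)) : ℂ) =
      ∑ x ∈ Fintype.piFinset (fun _ : Fin k ↦ range (N + 1)),
        (∏ i, (f i (x i) : ℂ)) * (𝐞 ((((∑ i, x i : ℕ) : ℤ) - N : ℤ) * α) : ℂ) := by
    intro α
    simp only [expSumOf]
    rw [Finset.prod_univ_sum, Finset.sum_mul]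
    refine sum_congr rfl fun x _ ↦ ?_
    rw [prod_mul_distrib, mul_assoc, hchar]
  simp_rw [hI]
  rw [intervalIntegral.integral_finsetSum fun x _ ↦ Continuous.intervalIntegrable (by fun_prop) _ _]
  have horth : ∀ m : ℤ, ∫ α in (0 : ℝ)..1, (𝐞 (m * α) : ℂ) = if m = 0 then 1 else 0 :=
    integral_fourierChar_intCast_holds
  simp_rw [intervalIntegral.integral_const_mul, horth]
  rw [← filter_piFinset_range_sum_eq_antidiagonalTuple, Finset.sum_filter]
  refine sum_congr rfl fun x _ ↦ ?_
  have hiff : ((((∑ i, x i : ℕ) : ℤ) - N : ℤ) = 0) ↔ ∑ i, x i = N := by omega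
  simp_rw [mul_ite, mul_one, mul_zero, hiff]

/-- `ternarySum` as a sum over `antidiagonalTuple 3 N` of a product over `Fin 3` (private helper). [folklore] -/
private theorem ternarySum_eq_sum_prod (f₁ f₂ f₃ : ℕ → ℝ) (N : ℕ) :
    ternarySum f₁ f₂ f₃ N = ∑ x ∈ Finset.Nat.antidiagonalTuple 3 N, ∏ i, ![f₁, f₂, f₃] i (x i) := by
  unfold ternarySum
  refine sum_congr rfl fun x _ ↦ ?_
  simp [Fin.prod_univ_three]

/-- `∑_{n₁+n₂+n₃=N} f₁f₂f₃ = ∫₀¹ f̂₁ f̂₂ f̂₃ e(−Nα) dα`. [cite: Vaughan1997, §1.2 (the number of representations as the integral of the product of generating functions against e(−Nα))] -/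
theorem ternarySum_eq_integral (f₁ f₂ f₃ : ℕ → ℝ) (N : ℕ) :
    (ternarySum f₁ f₂ f₃ N : ℂ) =
      ∫ α in (0 : ℝ)..1,
        expSumOf f₁ N α * expSumOf f₂ N α * expSumOf f₃ N α * (𝐞 (-(N * α)) : ℂ) := by
  rw [ternarySum_eq_sum_prod]
  push_cast
  rw [← integral_prod_expSumOf_mul_fourierChar 3 ![f₁, f₂, f₃] N]
  refine intervalIntegral.integral_congr fun α _ ↦ ?_
  simp [Fin.prod_univ_three]

/-- `|∑_{n₁+n₂+n₃=N} f₁f₂f₃| ≤ ∫₀¹ |f̂₁||f̂₂||f̂₃|`. [cite: Vaughan1997, §1.2 (triangle inequality on the representation integral)] -/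
theorem abs_ternarySum_le_integral (f₁ f₂ f₃ : ℕ → ℝ) (N : ℕ) :
    |ternarySum f₁ f₂ f₃ N| ≤
      ∫ α in (0 : ℝ)..1, ‖expSumOf f₁ N α‖ * ‖expSumOf f₂ N α‖ * ‖expSumOf f₃ N α‖ := by
  rw [← Real.norm_eq_abs, ← Complex.norm_real, ternarySum_eq_integral]
  refine (intervalIntegral.norm_integral_le_integral_norm zero_le_one).trans_eq ?_
  refine intervalIntegral.integral_congr fun α _ ↦ ?_
  simp only [norm_mul, Circle.norm_coe, mul_one]

/-! ### Parseval -/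

/-- `|f̂(α)|² = ∑_{n,m} f(n)f(m) e((n−m)α)` (private helper for Parseval). [folklore] -/
private theorem norm_sq_expSumOf_eq (f : ℕ → ℝ) (N : ℕ) (α : ℝ) :
    ((‖expSumOf f N α‖ ^ 2 : ℝ) : ℂ) =
      ∑ n ∈ range (N + 1), ∑ m ∈ range (N + 1),
        ((f n * f m : ℝ) : ℂ) * (𝐞 ((((n : ℤ) - m : ℤ) : ℝ) * α) : ℂ) := by
  rw [expSumOf, ← Complex.normSq_eq_norm_sq, ← Complex.mul_conj, map_sum, Finset.sum_mul_sum]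
  refine Finset.sum_congr rfl fun n _ => Finset.sum_congr rfl fun m _ => ?_
  rw [map_mul (starRingEnd ℂ), Complex.conj_ofReal, ← Circle.coe_inv_eq_conj,
    ← AddChar.map_neg_eq_inv]
  have h : (𝐞 ((n : ℝ) * α) : ℂ) * (𝐞 (-((m : ℝ) * α)) : ℂ) =
      (𝐞 ((((n : ℤ) - m : ℤ) : ℝ) * α) : ℂ) := by
    rw [← Circle.coe_mul, ← AddChar.map_add_eq_mul]
    congr 2
    push_cast
    ring
  push_cast at h ⊢
  rw [← h]
  ring

/-- Parseval: `∫₀¹ |f̂(α)|² dα = ∑_{n ≤ N} f(n)²` (tree pattern: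
`GoldbachLinnik.integral_norm_sq_weightedExpSum`). [cite: Vaughan1997, §3.2 (Parseval's identity for the generating function)] -/
theorem integral_norm_sq_expSumOf (f : ℕ → ℝ) (N : ℕ) :
    ∫ α in (0 : ℝ)..1, ‖expSumOf f N α‖ ^ 2 = ∑ n ∈ range (N + 1), f n ^ 2 := by
  apply Complex.ofReal_injective
  rw [← intervalIntegral.integral_ofReal]
  simp_rw [norm_sq_expSumOf_eq]
  have hcont : ∀ (c : ℝ) (k : ℤ), Continuous fun α : ℝ => (c : ℂ) * (𝐞 ((k : ℝ) * α) : ℂ) :=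
    fun c k => continuous_const.mul (continuous_subtype_val.comp
      (Real.continuous_fourierChar.comp (continuous_const.mul continuous_id)))
  have horth : ∀ n : ℤ, ∫ α in (0 : ℝ)..1, (𝐞 (n * α) : ℂ) = if n = 0 then 1 else 0 :=
    integral_fourierChar_intCast_holds
  rw [intervalIntegral.integral_finsetSum fun p _ =>
    (continuous_finsetSum _ fun q _ => hcont _ _).intervalIntegrable _ _]
  simp_rw [intervalIntegral.integral_finsetSum fun q _ => (hcont _ _).intervalIntegrable _ _,
    intervalIntegral.integral_const_mul, horth, sub_eq_zero, Nat.cast_inj]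
  push_cast
  refine Finset.sum_congr rfl fun n hn => ?_
  rw [Finset.sum_congr rfl fun x _ => by rw [mul_ite, mul_one, mul_zero], Finset.sum_ite_eq,
    if_pos hn, sq]

/-! ### Cauchy–Schwarz and Hölder -/

/-- `∫₀¹ |f̂₁||f̂₂| ≤ (‖f₁‖₂² ‖f₂‖₂²)^{1/2}` (Cauchy–Schwarz + Parseval). [cite: Vaughan1997, §3.2 (Cauchy's inequality and Parseval's identity on the minor arcs)] -/
theorem integral_norm_mul_norm_le (f₁ f₂ : ℕ → ℝ) (N : ℕ) :
    ∫ α in (0 : ℝ)..1, ‖expSumOf f₁ N α‖ * ‖expSumOf f₂ N α‖ ≤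
      ((∑ n ∈ range (N + 1), f₁ n ^ 2) * (∑ n ∈ range (N + 1), f₂ n ^ 2)) ^ ((1 : ℝ) / 2) := by
  have hS₁ : 0 ≤ ∑ n ∈ range (N + 1), f₁ n ^ 2 := sum_nonneg fun _ _ ↦ sq_nonneg _
  have hS₂ : 0 ≤ ∑ n ∈ range (N + 1), f₂ n ^ 2 := sum_nonneg fun _ _ ↦ sq_nonneg _
  have hH := integral_mul_le_Lp_mul_Lq_of_nonneg (μ := volume.restrict (Set.Ioc (0 : ℝ) 1))
    Real.HolderConjugate.two_two
    (f := fun α ↦ ‖expSumOf f₁ N α‖) (g := fun α ↦ ‖expSumOf f₂ N α‖)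
    (Filter.Eventually.of_forall fun _ ↦ norm_nonneg _)
    (Filter.Eventually.of_forall fun _ ↦ norm_nonneg _)
    (memLp_norm_expSumOf f₁ N _ _) (memLp_norm_expSumOf f₂ N _ _)
  have hP : ∀ f : ℕ → ℝ,
      ∫ a in Set.Ioc (0 : ℝ) 1, ‖expSumOf f N a‖ ^ (2 : ℝ) = ∑ n ∈ range (N + 1), f n ^ 2 := by
    intro f
    simp_rw [Real.rpow_two]
    rw [← intervalIntegral.integral_of_le zero_le_one]
    exact integral_norm_sq_expSumOf f N
  rw [hP, hP] at hH
  rw [intervalIntegral.integral_of_le zero_le_one]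
  refine hH.trans_eq ?_
  rw [← Real.mul_rpow hS₁ hS₂]

/-- Hölder `(4/3, 4)` with the pointwise bound `(|f̂₁||f̂₂|)^{4/3} ≤ (U₁U₂)^{1/3} |f̂₁||f̂₂|`:
`∫₀¹ |f̂₁||f̂₂||f̂₃| ≤ ((U₁U₂)^{1/3} ∫|f̂₁||f̂₂|)^{3/4} (∫|f̂₃|⁴)^{1/4}`. [cite: TaoVu2006, §10.2 (ternary counts controlled by L^q norms on the Fourier side, cf. Theorem 10.20)] -/
theorem integral_triple_le (f₁ f₂ f₃ : ℕ → ℝ) (N : ℕ) (U₁ U₂ : ℝ) (hU₁ : 0 ≤ U₁)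
    (h₁ : ∀ α : ℝ, ‖expSumOf f₁ N α‖ ≤ U₁) (h₂ : ∀ α : ℝ, ‖expSumOf f₂ N α‖ ≤ U₂) :
    ∫ α in (0 : ℝ)..1, ‖expSumOf f₁ N α‖ * ‖expSumOf f₂ N α‖ * ‖expSumOf f₃ N α‖ ≤
      ((U₁ * U₂) ^ ((1 : ℝ) / 3) *
          ∫ α in (0 : ℝ)..1, ‖expSumOf f₁ N α‖ * ‖expSumOf f₂ N α‖) ^ ((3 : ℝ) / 4) *
        (∫ α in (0 : ℝ)..1, ‖expSumOf f₃ N α‖ ^ 4) ^ ((1 : ℝ) / 4) := by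
  have hpq : Real.HolderConjugate (4 / 3 : ℝ) 4 := ⟨by norm_num, by norm_num, by norm_num⟩
  have hcont12 : Continuous fun α : ℝ ↦ ‖expSumOf f₁ N α‖ * ‖expSumOf f₂ N α‖ :=
    (continuous_expSumOf f₁ N).norm.mul (continuous_expSumOf f₂ N).norm
  have h12nn : ∀ α : ℝ, 0 ≤ ‖expSumOf f₁ N α‖ * ‖expSumOf f₂ N α‖ :=
    fun α ↦ mul_nonneg (norm_nonneg _) (norm_nonneg _)
  have h12le : ∀ α : ℝ, ‖expSumOf f₁ N α‖ * ‖expSumOf f₂ N α‖ ≤ U₁ * U₂ :=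
    fun α ↦ mul_le_mul (h₁ α) (h₂ α) (norm_nonneg _) hU₁
  have hm12 : MemLp (fun α : ℝ ↦ ‖expSumOf f₁ N α‖ * ‖expSumOf f₂ N α‖) (ENNReal.ofReal (4 / 3))
      (volume.restrict (Set.Ioc (0 : ℝ) 1)) :=
    MemLp.of_bound hcont12.aestronglyMeasurable (U₁ * U₂)
      (Filter.Eventually.of_forall fun α ↦ by
        rw [Real.norm_of_nonneg (h12nn α)]
        exact h12le α)
  have hH := integral_mul_le_Lp_mul_Lq_of_nonneg (μ := volume.restrict (Set.Ioc (0 : ℝ) 1)) hpq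
    (f := fun α ↦ ‖expSumOf f₁ N α‖ * ‖expSumOf f₂ N α‖) (g := fun α ↦ ‖expSumOf f₃ N α‖)
    (Filter.Eventually.of_forall fun α ↦ h12nn α)
    (Filter.Eventually.of_forall fun _ ↦ norm_nonneg _) hm12 (memLp_norm_expSumOf f₃ N _ _)
  have e1 : (1 : ℝ) / (4 / 3) = 3 / 4 := by norm_num
  rw [e1] at hH
  simp_rw [Real.rpow_ofNat] at hH
  rw [intervalIntegral.integral_of_le zero_le_one, intervalIntegral.integral_of_le zero_le_one,
    intervalIntegral.integral_of_le zero_le_one]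
  refine hH.trans (mul_le_mul_of_nonneg_right (Real.rpow_le_rpow
    (integral_nonneg fun α ↦ Real.rpow_nonneg (h12nn α) _) ?_ (by norm_num))
    (Real.rpow_nonneg (integral_nonneg fun α ↦ by positivity) _))
  rw [← integral_const_mul]
  refine integral_mono_of_nonneg (Filter.Eventually.of_forall fun α ↦ Real.rpow_nonneg (h12nn α) _)
    (hcont12.integrableOn_Ioc.const_mul _) (Filter.Eventually.of_forall fun α ↦ ?_)
  change (‖expSumOf f₁ N α‖ * ‖expSumOf f₂ N α‖) ^ ((4 : ℝ) / 3) ≤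
    (U₁ * U₂) ^ ((1 : ℝ) / 3) * (‖expSumOf f₁ N α‖ * ‖expSumOf f₂ N α‖)
  rw [show (4 : ℝ) / 3 = 1 / 3 + 1 by norm_num, Real.rpow_add' (h12nn α) (by norm_num), Real.rpow_one]
  exact mul_le_mul_of_nonneg_right (Real.rpow_le_rpow (h12nn α) (h12le α) (by norm_num)) (h12nn α)

/-! ### E5 assembled -/

/-- **The Hölder counting lemma holds** (orthogonality, Hölder `(4/3, 4)`, Cauchy–Schwarz, Parseval).
[cite: TaoVu2006, §10.2 (ternary counts controlled by L^q norms on the Fourier side, cf. Theorem 10.20)] -/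
theorem holderCounting_holds : HolderCounting := by
  intro f₁ f₂ f₃ N U₁ U₂ hU₁ hU₂ h₁ h₂
  have hS₁ : 0 ≤ ∑ n ∈ range (N + 1), f₁ n ^ 2 := sum_nonneg fun _ _ ↦ sq_nonneg _
  have hS₂ : 0 ≤ ∑ n ∈ range (N + 1), f₂ n ^ 2 := sum_nonneg fun _ _ ↦ sq_nonneg _
  have hU : 0 ≤ (U₁ * U₂) ^ ((1 : ℝ) / 3) := Real.rpow_nonneg (mul_nonneg hU₁ hU₂) _
  have hI : 0 ≤ ∫ α in (0 : ℝ)..1, ‖expSumOf f₁ N α‖ * ‖expSumOf f₂ N α‖ :=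
    intervalIntegral.integral_nonneg zero_le_one fun α _ ↦ mul_nonneg (norm_nonneg _) (norm_nonneg _)
  have hI₄ : 0 ≤ ∫ α in (0 : ℝ)..1, ‖expSumOf f₃ N α‖ ^ 4 :=
    intervalIntegral.integral_nonneg zero_le_one fun α _ ↦ by positivity
  calc |ternarySum f₁ f₂ f₃ N|
      ≤ ∫ α in (0 : ℝ)..1, ‖expSumOf f₁ N α‖ * ‖expSumOf f₂ N α‖ * ‖expSumOf f₃ N α‖ :=
        abs_ternarySum_le_integral f₁ f₂ f₃ N
    _ ≤ ((U₁ * U₂) ^ ((1 : ℝ) / 3) *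
            ∫ α in (0 : ℝ)..1, ‖expSumOf f₁ N α‖ * ‖expSumOf f₂ N α‖) ^ ((3 : ℝ) / 4) *
          (∫ α in (0 : ℝ)..1, ‖expSumOf f₃ N α‖ ^ 4) ^ ((1 : ℝ) / 4) :=
        integral_triple_le f₁ f₂ f₃ N U₁ U₂ hU₁ h₁ h₂
    _ ≤ ((U₁ * U₂) ^ ((1 : ℝ) / 3) *
            ((∑ n ∈ range (N + 1), f₁ n ^ 2) * (∑ n ∈ range (N + 1), f₂ n ^ 2)) ^ ((1 : ℝ) / 2)) ^
              ((3 : ℝ) / 4) *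
          (∫ α in (0 : ℝ)..1, ‖expSumOf f₃ N α‖ ^ 4) ^ ((1 : ℝ) / 4) :=
        mul_le_mul_of_nonneg_right
          (Real.rpow_le_rpow (mul_nonneg hU hI)
            (mul_le_mul_of_nonneg_left (integral_norm_mul_norm_le f₁ f₂ N) hU) (by norm_num))
          (Real.rpow_nonneg hI₄ _)
    _ = (U₁ * U₂) ^ ((1 : ℝ) / 4) *
          ((∑ n ∈ range (N + 1), f₁ n ^ 2) * (∑ n ∈ range (N + 1), f₂ n ^ 2)) ^ ((3 : ℝ) / 8) *
            (∫ α in (0 : ℝ)..1, ‖expSumOf f₃ N α‖ ^ 4) ^ ((1 : ℝ) / 4) := by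
        rw [Real.mul_rpow hU (Real.rpow_nonneg (mul_nonneg hS₁ hS₂) _),
          ← Real.rpow_mul (mul_nonneg hU₁ hU₂), ← Real.rpow_mul (mul_nonneg hS₁ hS₂)]
        norm_num

end Literature.NumberTheory.Sieve.CubicMinorant

end
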